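import Summits.BirchSwinnertonDyer.BirchSwinnertonDyer.Theorems.EdixhovenFibreFiveSevenTwistDegreeStepFiveSevenKP
import Literature.NumberTheory.EllipticCurves.QuadraticTwistKroneckerRootNumberProofs
import Literature.NumberTheory.EllipticCurves.LFunctionSmulProofs
import Literature.NumberTheory.EllipticCurves.CuspFormTwist
import Literature.NumberTheory.EllipticCurves.NewformsTwistNewProofs
import Literature.NumberTheory.EllipticCurves.CuspFormLFunctionLevelConductorProofs
import HarnessLib

/-!
# Route `EdixhovenFibreFiveSeven`, crux TDS57 (stmt-BirchSwinnertonDyer-22227), input (L-TWIST), part (C-ii):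
# the newform of the `q*`-twist `Vχ` IS the character twist `f_χ` of the newform `f` of `V₀`, at level `M q²`
# (`--supports`, helper)

Cell `pub/bsd-wall` (D-0145 line `route-BirchSwinnertonDyer-EdixhovenFibreFiveSeven`), seat `bsd-line-edix-p3`
(prover), part (C) of the three-seat split of (L-TWIST) (bus 2026-08-28T00:27:17Z: (A) edix-p2 = the `Γ₀`
twisted-period identity, (B) manin-p1 = three-copy Ihara, (C) edix-p3 = non-Eisenstein bridge + newform of the
twist). THEOREMS ONLY (no definition, no named fact, no `sorry`). CONDITIONAL only on modularity
`exists_isNewformOf` where the LEVEL of the twisted newform is pinned. Nothing is closed; BSD is not proved.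

## What and why

In (L-TWIST) — hypothesis `hLT` of `TwistDegreeStepFiveSevenKPTors.twistDegreeStepFiveSeven_of_kato_of_periodTwist`
(p589348) — the period lattice `Λ(g)` of an ARBITRARY newform `g` of the twisted curve `Vχ` (a globally minimal
model `v • V₀^{(q*)}`, `q*  = (−1)^{(q−1)/2} q`, `q ∤ 2N(V₀)`) at an arbitrary level `N'` occurs, while part (A)
computes with the explicit twist `f_χ = charTwist (M q²) … f` of the newform `f` of `V₀` (level `M = N(V₀)`) by
the primitive quadratic character `χ = (·/q)`. This file identifies the two:

* `exists_jacobiChar` — the Legendre character mod the odd prime `q` as a primitive quadratic Dirichlet character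
  (`exists_dirichletCharacter_eq_jacobiSym`);
* `lFunction_twistModel_eq` — `aₙ(Vχ) = (n/q)·aₙ(V₀)` for ALL `n ≥ 1` (any model of the twist: `LFunction_smul`;
  the Kronecker-twist law `LFunction_quadraticTwist_apply_of_int_gcd_eq_one`, `q* ≡ 1 (mod 4)`, `(q*, N(V₀)) = 1`);
* `conductorNorm_twistModel_eq` — `N(Vχ) = N(V₀)·q²` (`conductorNorm_quadraticTwist_of_emod_four_eq_one`,
  Atkin–Lehner §6; uses modularity);
* **`isNewformOf_twist_charTwist`** — `f_χ = charTwist (M q²) _ _ hχ f` IS a newform of `Vχ` for `f` the newform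
  of `V₀` at a level `M` with `q ∤ M` and `χ` the Legendre character (Atkin–Li newness: tree theorem
  `isNewform0_charTwist_of_isPrimePow_of_coprime`; coefficients by `cuspCoeff_charTwist`) — NO modularity;
* **`level_eq_and_periodLattice_newform_twist_eq`** / **`newform_twist_eq_charTwist`** — for EVERY newform `g` of
  `Vχ` at ANY level `N'`: `N' = M·q²` (`IsNewformOf.level_eq_level`) and
  `periodLattice g = periodLattice (charTwist (M q²) _ _ hχ f)` (an equality of subgroups of `ℂ`; at level `M q²`
  literally `g = charTwist …`, `q`-expansion principle `eq_of_forall_cuspCoeff_eq_gamma0`) — NO modularity;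
* `level_eq_and_cuspCoeff_newform_twist_eq` — the same read through conductors (uses modularity).

References: [Shimura1971] Prop. 3.64; [AtkinLehner1970] §6; [MurtyMurty1997] Ch. 6 §1; [SilvermanAEC2009]
X.2, Exercise 10.16.
-/

set_option autoImplicit false
-- the Theorems directory repeats the summit name (sibling precedent `SignedBaseChangeAssembly.lean`)
set_option linter.dupNamespace false

noncomputable section

open scoped Classical MatrixGroups NumberTheorySymbols

open WeierstrassCurve NumberField Literature.NumberTheory.EllipticCurves
  Literature.NumberTheory.EllipticCurves.ModularForms
  CongruenceSubgroup

namespace Summit.BirchSwinnertonDyer.BirchSwinnertonDyer.Theorems.NewformTwist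

/-! ### §1 The Legendre character and the arithmetic of `q*` -/

/-- **The Legendre character mod an odd prime `q`** as a PRIMITIVE QUADRATIC Dirichlet character with values the
Jacobi (= Legendre) symbol (`exists_dirichletCharacter_eq_jacobiSym` at the odd squarefree modulus `q`).
[folklore] -/
theorem exists_jacobiChar {q : ℕ} (hq : q.Prime) (hq2 : q ≠ 2) :
    ∃ χ : DirichletCharacter ℂ q, χ.IsQuadratic ∧ χ.IsPrimitive ∧ ∀ a : ℤ, χ a = (J(a | q) : ℂ) :=
  exists_dirichletCharacter_eq_jacobiSym q (hq.odd_of_ne_two hq2) hq.squarefree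

/-- `q* = (−1)^{(q−1)/2} q` has `q* ≡ 1 (mod 4)`, is squarefree, has `|q*| = q`, and is prime to every `N` with
`q ∤ N`. [folklore] -/
theorem pStar_arith {q : ℕ} (hq : q.Prime) (hq2 : q ≠ 2) {N : ℕ} (hqN : ¬ q ∣ N) :
    ((-1 : ℤ) ^ (q / 2) * q) % 4 = 1 ∧ Squarefree ((-1 : ℤ) ^ (q / 2) * q) ∧
      ((-1 : ℤ) ^ (q / 2) * q : ℤ).natAbs = q ∧ Int.gcd ((-1 : ℤ) ^ (q / 2) * q) N = 1 := by
  have hodd : q % 2 = 1 := Nat.odd_iff.mp (hq.odd_of_ne_two hq2)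
  have habs : ((-1 : ℤ) ^ (q / 2) * q : ℤ).natAbs = q := by
    rw [Int.natAbs_mul, Int.natAbs_pow, Int.natAbs_neg, Int.natAbs_one, one_pow, one_mul,
      Int.natAbs_natCast]
  have h4 : ((-1 : ℤ) ^ (q / 2) * q) % 4 = 1 := by
    rcases Nat.even_or_odd (q / 2) with he | ho
    · rw [he.neg_one_pow, one_mul]
      obtain ⟨k, hk⟩ := he
      omega
    · rw [ho.neg_one_pow]
      obtain ⟨k, hk⟩ := ho
      omega
  refine ⟨h4, ?_, habs, ?_⟩
  · rw [← Int.squarefree_natAbs, habs]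
    exact hq.squarefree
  · rw [Int.gcd_eq_natAbs, habs, Int.natAbs_natCast]
    exact (Nat.Prime.coprime_iff_not_dvd hq).mpr hqN

/-! ### §2 Coefficients and conductor of a model of the `q*`-twist -/

section Model

variable (V₀ : WeierstrassCurve ℚ) [V₀.IsElliptic] {q : ℕ} (hq : q.Prime) (hq2 : q ≠ 2)
  (hqN : ¬ q ∣ V₀.conductorNorm ℤ) (Vχ : WeierstrassCurve ℚ) (v : VariableChange ℚ)
  (hv : v • V₀.quadraticTwist (((-1 : ℤ) ^ (q / 2) * q : ℤ) : ℚ) = Vχ)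
include hq hq2 hqN hv

/-- **`aₙ(Vχ) = (n/q)·aₙ(V₀)` for all `n ≥ 1`** for any model `Vχ = v • V₀^{(q*)}` of the twist by
`q* = (−1)^{(q−1)/2} q`, `q` an odd prime of good reduction (`q ∤ N(V₀)`): the Kronecker-twist law
`LFunction_quadraticTwist_apply_of_int_gcd_eq_one` (`q* ≡ 1 (mod 4)`, squarefree, `(q*, N) = 1`, `|q*| = q`) and
isomorphism invariance of the `L`-function (`LFunction_smul`). [cite: SilvermanAEC2009, X.2 and Exercise 10.16] -/
theorem lFunction_twistModel_eq (n : ℕ) : Vχ.LFunction n = J((n : ℤ) | q) * V₀.LFunction n := by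
  obtain ⟨h4, hsq, habs, hgcd⟩ := pStar_arith hq hq2 hqN
  have hd0 : ((((-1 : ℤ) ^ (q / 2) * q : ℤ)) : ℚ) ≠ 0 := by
    have : ((-1 : ℤ) ^ (q / 2) * q : ℤ) ≠ 0 :=
      mul_ne_zero (pow_ne_zero _ (by norm_num)) (by exact_mod_cast hq.ne_zero)
    exact_mod_cast this
  haveI := V₀.isElliptic_quadraticTwist hd0
  rw [← hv, LFunction_smul, LFunction_quadraticTwist_apply_of_int_gcd_eq_one V₀ h4 hsq hgcd n, habs]

/-- **`N(Vχ) = N(V₀)·q²`** for any model of the `q*`-twist at an odd prime `q ∤ N(V₀)` (Atkin–Lehner §6: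
`conductorNorm_quadraticTwist_of_emod_four_eq_one`, which uses modularity; isomorphism invariance
`conductorNorm_smul`). [cite: AtkinLehner1970, §6] -/
theorem conductorNorm_twistModel_eq (hnf : exists_isNewformOf) :
    Vχ.conductorNorm ℤ = V₀.conductorNorm ℤ * q ^ 2 := by
  obtain ⟨h4, hsq, habs, hgcd⟩ := pStar_arith hq hq2 hqN
  have hd0 : ((((-1 : ℤ) ^ (q / 2) * q : ℤ)) : ℚ) ≠ 0 := by
    have : ((-1 : ℤ) ^ (q / 2) * q : ℤ) ≠ 0 :=
      mul_ne_zero (pow_ne_zero _ (by norm_num)) (by exact_mod_cast hq.ne_zero)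
    exact_mod_cast this
  haveI := V₀.isElliptic_quadraticTwist hd0
  rw [← hv, conductorNorm_smul ℤ _ v, V₀.conductorNorm_quadraticTwist_of_emod_four_eq_one hnf h4 hsq hgcd,
    habs]

/-! ### §3 The newform of the twist -/

/-- **`f_χ` IS a newform of the twisted curve.** For `f` the newform of `V₀` at a level `M` with `q ∤ M` and `χ`
the Legendre character mod `q` (primitive quadratic, `χ(a) = (a/q)`), the twist
`charTwist (M q²) _ _ hχ f ∈ S₂(Γ₀(M q²))` is a normalised newform (Atkin–Li: tree theorem
`isNewform0_charTwist_of_isPrimePow_of_coprime`) with the Dirichlet coefficients of `Vχ`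
(`cuspCoeff_charTwist` and `lFunction_twistModel_eq`). No modularity hypothesis.
[cite: AtkinLehner1970, §6] [cite: Shimura1971, Prop. 3.64] -/
theorem isNewformOf_twist_charTwist [NeZero q] {M : ℕ} [NeZero M] {f : CuspForm (Gamma0 M) 2}
    (hf : IsNewformOf V₀ f) (hqM : ¬ q ∣ M) {χ : DirichletCharacter ℂ q} (hχ : χ.IsQuadratic)
    (hprim : χ.IsPrimitive) (hχJ : ∀ a : ℤ, χ a = (J(a | q) : ℂ)) [NeZero (M * q ^ 2)] :
    IsNewformOf Vχ (charTwist (M * q ^ 2) (dvd_mul_right M (q ^ 2)) (dvd_mul_left (q ^ 2) M) hχ f) := by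
  have hMq : M.Coprime q := ((Nat.Prime.coprime_iff_not_dvd hq).mpr hqM).symm
  refine ⟨isNewform0_charTwist_of_isPrimePow_of_coprime hχ hprim hq.isPrimePow hMq hf.1, fun n ↦ ?_⟩
  rw [cuspCoeff_charTwist _ _ _ hχ hprim f n, hf.2 n, lFunction_twistModel_eq V₀ hq hq2 hqN Vχ v hv n]
  have := hχJ n
  rw [Int.cast_natCast] at this
  rw [this]
  push_cast
  ring

/-- **Level and period lattice of ANY newform of the twist.** For `f` the newform of `V₀` (level `M`, `q ∤ M`)
and any newform `g` of `Vχ` at any level `N'`: `N' = M·q²` (multiplicity one in the tree's form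
`IsNewformOf.level_eq_level`, against the newform `f_χ` of `isNewformOf_twist_charTwist`) and
`periodLattice g = periodLattice (charTwist (M q²) … f)` — an equality of subgroups of `ℂ`, no transport
needed (the `q`-expansion principle `eq_of_forall_cuspCoeff_eq_gamma0` after identifying the levels).
No modularity hypothesis. [cite: AtkinLehner1970, §6] [cite: Shimura1971, Prop. 3.64] -/
theorem level_eq_and_periodLattice_newform_twist_eq [NeZero q] {M : ℕ} [NeZero M]
    {f : CuspForm (Gamma0 M) 2} (hf : IsNewformOf V₀ f) (hqM : ¬ q ∣ M) {χ : DirichletCharacter ℂ q}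
    (hχ : χ.IsQuadratic) (hprim : χ.IsPrimitive) (hχJ : ∀ a : ℤ, χ a = (J(a | q) : ℂ)) [NeZero (M * q ^ 2)]
    {N' : ℕ} [NeZero N'] (g : CuspForm (Gamma0 N') 2) (hg : IsNewformOf Vχ g) :
    N' = M * q ^ 2 ∧
      periodLattice g =
        periodLattice (charTwist (M * q ^ 2) (dvd_mul_right M (q ^ 2)) (dvd_mul_left (q ^ 2) M) hχ f) := by
  have hF := isNewformOf_twist_charTwist V₀ hq hq2 hqN Vχ v hv hf hqM hχ hprim hχJ
  have hN : N' = M * q ^ 2 := IsNewformOf.level_eq_level hg hF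
  subst hN
  refine ⟨rfl, ?_⟩
  rw [show g = charTwist (M * q ^ 2) (dvd_mul_right M (q ^ 2)) (dvd_mul_left (q ^ 2) M) hχ f from
    eq_of_forall_cuspCoeff_eq_gamma0 fun n ↦ by rw [hg.2 n, hF.2 n]]

/-- **The newform of the twist at level `M q²` IS `f_χ`, literally** (the shape part (A) of (L-TWIST) plugs into
by `subst`): for any newform `g` of `Vχ` on `Γ₀(M q²)`,
`g = charTwist (M * q ^ 2) (dvd_mul_right M (q ^ 2)) (dvd_mul_left (q ^ 2) M) hχ f`.
[cite: Shimura1971, Prop. 3.64] -/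
theorem newform_twist_eq_charTwist [NeZero q] {M : ℕ} [NeZero M] {f : CuspForm (Gamma0 M) 2}
    (hf : IsNewformOf V₀ f) (hqM : ¬ q ∣ M) {χ : DirichletCharacter ℂ q} (hχ : χ.IsQuadratic)
    (hprim : χ.IsPrimitive) (hχJ : ∀ a : ℤ, χ a = (J(a | q) : ℂ)) [NeZero (M * q ^ 2)]
    (g : CuspForm (Gamma0 (M * q ^ 2)) 2) (hg : IsNewformOf Vχ g) :
    g = charTwist (M * q ^ 2) (dvd_mul_right M (q ^ 2)) (dvd_mul_left (q ^ 2) M) hχ f :=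
  eq_of_forall_cuspCoeff_eq_gamma0 fun n ↦ by
    rw [hg.2 n, (isNewformOf_twist_charTwist V₀ hq hq2 hqN Vχ v hv hf hqM hχ hprim hχJ).2 n]

/-- The same three facts with the levels read as conductors (under modularity `exists_isNewformOf`): for `f` the
newform of `V₀` at level `N(V₀)` and any newform `g` of `Vχ` at level `N'`, `N' = N(V₀)·q²` and
`aₙ(g) = (n/q)·aₙ(f)` for all `n`. [cite: AtkinLehner1970, §6] -/
theorem level_eq_and_cuspCoeff_newform_twist_eq [Vχ.IsElliptic] (hnf : exists_isNewformOf) {M : ℕ} [NeZero M]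
    {f : CuspForm (Gamma0 M) 2} (hf : IsNewformOf V₀ f) {N' : ℕ} [NeZero N'] (g : CuspForm (Gamma0 N') 2)
    (hg : IsNewformOf Vχ g) :
    N' = M * q ^ 2 ∧ ∀ n : ℕ, cuspCoeff g n = (J((n : ℤ) | q) : ℂ) * cuspCoeff f n := by
  have hM : M = V₀.conductorNorm ℤ := IsNewformOf.level_eq_conductorNorm_of_exists_isNewformOf hnf hf
  have hN' : N' = Vχ.conductorNorm ℤ := IsNewformOf.level_eq_conductorNorm_of_exists_isNewformOf hnf hg
  refine ⟨by rw [hN', conductorNorm_twistModel_eq V₀ hq hq2 hqN Vχ v hv hnf, hM], fun n ↦ ?_⟩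
  rw [hg.2 n, hf.2 n, lFunction_twistModel_eq V₀ hq hq2 hqN Vχ v hv n]
  push_cast
  ring

end Model

end Summit.BirchSwinnertonDyer.BirchSwinnertonDyer.Theorems.NewformTwist

end
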